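import Mathlib
import Summits.ValiantsHypothesis.ValiantsHypothesis.Theorems.ValuativeGCTHeadFlipRankBoundDefs
import Summits.ValiantsHypothesis.ValiantsHypothesis.Theorems.ValuativeGCTHeadFlipRankBoundPoints
import Summits.ValiantsHypothesis.ValiantsHypothesis.Theorems.ValuativeGCTValuativeFlipRankOneMaster

/-!
# V1 for the full `4n²` family of the rank-one moment-curve pencil: a relation kills the symmetric
# cubic `Q_T` at the special point `p_T` (crux `ValuativeGCT.ValuativeFlip`, stub `stub_fourRowPencilRank`)

Wall-breaker k1 (explicit per-side constructions), crux stmt-ValiantsHypothesis-12624, line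
`four-row-count`.  Second file of the four-multiplier count for the rank-one moment-curve pencil
(`Theorems/ValuativeGCTValuativeFlipRankOneMaster.lean`): evaluating the MASTER identity of a relation
`Σ_ab (L_ab + M_ab)·Per_ab = 0` at the special point `p_{ijk}` of the HeadFlip line
(`Theorems/ValuativeGCTHeadFlipRankBoundPoints.lean`) kills every `Ψ({a})`, `Ψ({a,b})` and all
`Ψ({a,b,c})` but those with `{a,b,c} = {i,j,k}`; what survives is `Ψ(T)(p_T) ≠ 0` times the value of the
symmetric cubic `Q_T = q_ij u_k + q_ik u_j + q_jk u_i`, `q_ab = L_ab u_b + L_ba u_a`, whence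
`Q_T(p_T) = 0` (`mcp_V1`; the HeadFlip line's `stub_rbV1` is the three-multiplier special case).
Also: the two finite-sum collapsing lemmas used here and by the `B`-relation analysis
(`mcp_sum2_collapse`, `mcp_sum3_collapse`).  No definitions. [this crux; new]
-/

-- `Summit.ValiantsHypothesis.ValiantsHypothesis.…` is the tree's mandated single-conjunct layout (Sub = Summit).
set_option linter.dupNamespace false

namespace Summit.ValiantsHypothesis.ValiantsHypothesis.Theorems.ValuativeFlip

open MvPolynomial Finset
open scoped BigOperators
open Summit.ValiantsHypothesis.ValiantsHypothesis.Theorems.HeadFlip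

noncomputable section

/-! ### Collapsing sums supported on one unordered pair / triple -/

/-- A double sum over ordered pairs of distinct indices whose terms vanish off the unordered pair
`{c, b}` collapses to the two orderings of that pair. [folklore] -/
theorem mcp_sum2_collapse {n : ℕ} {X : Type*} [AddCommMonoid X] (g : Fin n → Fin n → X)
    {c b : Fin n} (hcb : c ≠ b)
    (hvan : ∀ a a', a ≠ a' → ({a, a'} : Finset (Fin n)) ≠ {c, b} → g a a' = 0) :
    ∑ a, ∑ a' ∈ Finset.univ.erase a, g a a' = g c b + g b c := by
  classical
  have hrow : ∀ a, a ≠ c → a ≠ b → ∑ a' ∈ Finset.univ.erase a, g a a' = 0 := by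
    intro a hac hab
    refine Finset.sum_eq_zero fun a' ha' => hvan a a' (Finset.mem_erase.1 ha').1.symm ?_
    intro h
    have : a ∈ ({c, b} : Finset (Fin n)) := h ▸ Finset.mem_insert_self a {a'}
    simp only [Finset.mem_insert, Finset.mem_singleton] at this
    tauto
  rw [Finset.sum_eq_add c b hcb (fun a _ h => hrow a h.1 h.2) (fun h => absurd (Finset.mem_univ c) h)
    (fun h => absurd (Finset.mem_univ b) h)]
  congr 1
  · rw [Finset.sum_eq_single b]
    · intro a' ha' hne
      refine hvan c a' (Finset.mem_erase.1 ha').1.symm ?_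
      intro h
      have : a' ∈ ({c, b} : Finset (Fin n)) := h ▸ by simp
      simp only [Finset.mem_insert, Finset.mem_singleton] at this
      rcases this with h' | h'
      · exact (Finset.mem_erase.1 ha').1 h'
      · exact hne h'
    · intro h
      exact absurd (Finset.mem_erase.2 ⟨hcb.symm, Finset.mem_univ b⟩) h
  · rw [Finset.sum_eq_single c]
    · intro a' ha' hne
      refine hvan b a' (Finset.mem_erase.1 ha').1.symm ?_
      intro h
      have : a' ∈ ({c, b} : Finset (Fin n)) := h ▸ by simp
      simp only [Finset.mem_insert, Finset.mem_singleton] at this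
      rcases this with h' | h'
      · exact hne h'
      · exact (Finset.mem_erase.1 ha').1 h'
    · intro h
      exact absurd (Finset.mem_erase.2 ⟨hcb, Finset.mem_univ c⟩) h

/-- A triple sum over ordered triples of distinct indices whose terms vanish off the unordered
triple `{i, j, k}` collapses to the six orderings of that triple. [folklore] -/
theorem mcp_sum3_collapse {n : ℕ} {X : Type*} [AddCommMonoid X] (g : Fin n → Fin n → Fin n → X)
    {i j k : Fin n} (hij : i ≠ j) (hik : i ≠ k) (hjk : j ≠ k)
    (hvan : ∀ a b c, a ≠ b → a ≠ c → b ≠ c → ({a, b, c} : Finset (Fin n)) ≠ {i, j, k} → g a b c = 0) :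
    ∑ a, ∑ b ∈ Finset.univ.erase a, ∑ c ∈ (Finset.univ.erase a).erase b, g a b c =
      g i j k + g i k j + g j i k + g j k i + g k i j + g k j i := by
  classical
  -- membership bookkeeping
  have hmemT : ∀ {a b c : Fin n} (x : Fin n), ({a, b, c} : Finset (Fin n)) = {i, j, k} →
      x ∈ ({a, b, c} : Finset (Fin n)) → x = i ∨ x = j ∨ x = k := by
    intro a b c x h hx
    rw [h] at hx
    simpa only [Finset.mem_insert, Finset.mem_singleton] using hx
  -- inner sums: for fixed distinct `a, b`, the sum over `c` is a single term or zero
  have hinner : ∀ (a b c₀ : Fin n), a ≠ b → a ≠ c₀ → b ≠ c₀ →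
      (∀ c, c ≠ a → c ≠ b → c ≠ c₀ → ({a, b, c} : Finset (Fin n)) ≠ {i, j, k}) →
      ∑ c ∈ (Finset.univ.erase a).erase b, g a b c = g a b c₀ := by
    intro a b c₀ hab hac hbc hoff
    rw [Finset.sum_eq_single c₀]
    · intro c hc hne
      have hc' := Finset.mem_erase.1 hc
      have hc'' := Finset.mem_erase.1 hc'.2
      exact hvan a b c hab (Ne.symm hc''.1) (Ne.symm hc'.1) (hoff c hc''.1 hc'.1 hne)
    · intro h
      exact absurd (Finset.mem_erase.2 ⟨hbc.symm, Finset.mem_erase.2 ⟨hac.symm, Finset.mem_univ _⟩⟩) h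
  have hzero_inner : ∀ (a b : Fin n), a ≠ b →
      (∀ c, c ≠ a → c ≠ b → ({a, b, c} : Finset (Fin n)) ≠ {i, j, k}) →
      ∑ c ∈ (Finset.univ.erase a).erase b, g a b c = 0 := by
    intro a b hab hoff
    refine Finset.sum_eq_zero fun c hc => ?_
    have hc' := Finset.mem_erase.1 hc
    have hc'' := Finset.mem_erase.1 hc'.2
    exact hvan a b c hab (Ne.symm hc''.1) (Ne.symm hc'.1) (hoff c hc''.1 hc'.1)
  -- a triple `{a,b,c}` containing an element outside `{i,j,k}` is not `{i,j,k}`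
  have hoffT : ∀ {a b c : Fin n} (x : Fin n), x ∈ ({a, b, c} : Finset (Fin n)) →
      x ≠ i → x ≠ j → x ≠ k → ({a, b, c} : Finset (Fin n)) ≠ {i, j, k} := by
    intro a b c x hx h1 h2 h3 h
    rcases hmemT x h hx with h' | h' | h'
    · exact h1 h'
    · exact h2 h'
    · exact h3 h'
  have hmem1 : ∀ a b c : Fin n, a ∈ ({a, b, c} : Finset (Fin n)) := fun a b c => by simp
  have hmem2 : ∀ a b c : Fin n, b ∈ ({a, b, c} : Finset (Fin n)) := fun a b c => by simp
  have hmem3 : ∀ a b c : Fin n, c ∈ ({a, b, c} : Finset (Fin n)) := fun a b c => by simp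
  -- middle sums: for `a ∈ {i,j,k}`, the sum over `b` has two nonzero terms
  have hmid : ∀ (a b₁ b₂ : Fin n), a ≠ b₁ → a ≠ b₂ → b₁ ≠ b₂ →
      (∀ x, x = i ∨ x = j ∨ x = k ↔ x = a ∨ x = b₁ ∨ x = b₂) →
      ∑ b ∈ Finset.univ.erase a, ∑ c ∈ (Finset.univ.erase a).erase b, g a b c = g a b₁ b₂ + g a b₂ b₁ := by
    intro a b₁ b₂ hab₁ hab₂ hb₁₂ hperm
    have hout : ∀ x, x ≠ a → x ≠ b₁ → x ≠ b₂ → x ≠ i ∧ x ≠ j ∧ x ≠ k := by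
      intro x h1 h2 h3
      have := (hperm x).not.2 (by tauto)
      tauto
    have hin₁ : ∑ c ∈ (Finset.univ.erase a).erase b₁, g a b₁ c = g a b₁ b₂ := by
      refine hinner a b₁ b₂ hab₁ hab₂ hb₁₂ fun c h1 h2 h3 => ?_
      obtain ⟨c1, c2, c3⟩ := hout c h1 h2 h3
      exact hoffT c (hmem3 _ _ _) c1 c2 c3
    have hin₂ : ∑ c ∈ (Finset.univ.erase a).erase b₂, g a b₂ c = g a b₂ b₁ := by
      refine hinner a b₂ b₁ hab₂ hab₁ hb₁₂.symm fun c h1 h2 h3 => ?_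
      obtain ⟨c1, c2, c3⟩ := hout c h1 h3 h2
      exact hoffT c (hmem3 _ _ _) c1 c2 c3
    rw [Finset.sum_eq_add b₁ b₂ hb₁₂]
    · rw [hin₁, hin₂]
    · intro b hb hne
      have hba := (Finset.mem_erase.1 hb).1
      obtain ⟨c1, c2, c3⟩ := hout b hba hne.1 hne.2
      exact hzero_inner a b (Ne.symm hba) fun c _ _ => hoffT b (hmem2 _ _ _) c1 c2 c3
    · intro h
      exact absurd (Finset.mem_erase.2 ⟨hab₁.symm, Finset.mem_univ _⟩) h
    · intro h
      exact absurd (Finset.mem_erase.2 ⟨hab₂.symm, Finset.mem_univ _⟩) h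
  -- outer sum: three nonzero rows
  have hrow0 : ∀ a, a ≠ i → a ≠ j → a ≠ k →
      ∑ b ∈ Finset.univ.erase a, ∑ c ∈ (Finset.univ.erase a).erase b, g a b c = 0 := by
    intro a h1 h2 h3
    refine Finset.sum_eq_zero fun b hb => ?_
    exact hzero_inner a b (Ne.symm (Finset.mem_erase.1 hb).1) fun c _ _ => hoffT a (hmem1 _ _ _) h1 h2 h3
  set G : Fin n → X := fun a => ∑ b ∈ Finset.univ.erase a, ∑ c ∈ (Finset.univ.erase a).erase b, g a b c
    with hG
  have houter : ∑ a, G a = G i + (G j + G k) := by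
    rw [← Finset.add_sum_erase _ _ (Finset.mem_univ i),
      ← Finset.add_sum_erase _ _ (Finset.mem_erase.2 ⟨hij.symm, Finset.mem_univ j⟩),
      Finset.sum_eq_single k]
    · intro a ha hak
      have ha' := Finset.mem_erase.1 ha
      have ha'' := Finset.mem_erase.1 ha'.2
      exact hrow0 a ha''.1 ha'.1 hak
    · intro h
      exact absurd (Finset.mem_erase.2 ⟨hjk.symm, Finset.mem_erase.2 ⟨hik.symm, Finset.mem_univ k⟩⟩) h
  rw [houter, hG]
  dsimp only
  rw [hmid i j k hij hik hjk (fun x => Iff.rfl), hmid j i k hij.symm hjk hik (fun x => by tauto),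
    hmid k i j hik.symm hjk.symm hij (fun x => by tauto)]
  abel

/-! ### V1: a relation kills the symmetric cubic `Q_T` at the special point `p_T` -/

/-- Three pairwise distinct indices do not all lie in a two-element finset. [folklore] -/
theorem mcp_not_all_mem_pair {n : ℕ} {i j k : Fin n} (hij : i ≠ j) (hik : i ≠ k) (hjk : j ≠ k)
    (a b : Fin n) : i ∉ ({a, b} : Finset (Fin n)) ∨ j ∉ ({a, b} : Finset (Fin n)) ∨ k ∉ ({a, b} : Finset (Fin n)) := by
  by_contra h
  push Not at h
  obtain ⟨hi, hj, hk⟩ := h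
  simp only [Finset.mem_insert, Finset.mem_singleton] at hi hj hk
  rcases hi with rfl | rfl <;> rcases hj with h1 | h1 <;> rcases hk with h2 | h2 <;>
    simp_all

/-- Two distinct indices do not both lie in a singleton. [folklore] -/
theorem mcp_not_all_mem_singleton {n : ℕ} {i j k : Fin n} (hij : i ≠ j) (a : Fin n) :
    i ∉ ({a} : Finset (Fin n)) ∨ j ∉ ({a} : Finset (Fin n)) ∨ k ∉ ({a} : Finset (Fin n)) := by
  by_contra h
  push Not at h
  simp only [Finset.mem_singleton] at h
  exact hij (h.1.trans h.2.1.symm)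

/-- **V1 (four multipliers).**  A relation `Σ_ab (L_ab + M_ab)·Per_ab = 0` (`L` of `B`-weight `0`, `M`
of `B`-weight `1`) kills, at every special point `p_{ijk}`, the symmetric cubic
`Q_{ijk} = q_ij u_k + q_ik u_j + q_jk u_i`, `q_ab = L_ab u_b + L_ba u_a`: evaluate the MASTER identity
at `p_{ijk}` — every `Ψ({a})`, `Ψ({a,b})` vanishes there, and `Ψ({a,b,c})` survives only for
`{a,b,c} = {i,j,k}`. [this crux; new] -/
theorem mcp_V1 : ∀ {n : ℕ} (L M : Fin n → Fin n → MvPolynomial (Fin 4) ℂ),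
    (∀ a b, MvPolynomial.IsWeightedHomogeneous (![0, 1, 1, 0] : Fin 4 → ℕ) (L a b) 0) →
    (∀ a b, MvPolynomial.IsWeightedHomogeneous (![0, 1, 1, 0] : Fin 4 → ℕ) (M a b) 1) →
    (∑ a, ∑ b, (L a b + M a b) * rbPer a b = 0) →
    ∀ (i j k : Fin n), i ≠ j → i ≠ k → j ≠ k →
      MvPolynomial.eval (rbPt i j k) ((L i j * rbU j + L j i * rbU i) * rbU k +
        (L i k * rbU k + L k i * rbU i) * rbU j + (L j k * rbU k + L k j * rbU j) * rbU i) = 0 := by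
  intro n L M hL hM hrel i j k hij hik hjk
  have hmaster := congrArg (MvPolynomial.eval (rbPt i j k)) (mcp_master L M hL hM hrel)
  rw [map_zero, map_add, map_sub, map_sub] at hmaster
  -- the pair and singleton sums vanish at `p_{ijk}`
  have h1 : MvPolynomial.eval (rbPt i j k)
      (∑ a, ∑ b ∈ Finset.univ.erase a, (L a a + L a b) * rbU b * rbPsi {a, b}) = 0 := by
    rw [map_sum]
    refine Finset.sum_eq_zero fun a _ => ?_
    rw [map_sum]
    refine Finset.sum_eq_zero fun b _ => ?_
    rw [map_mul, rbPsi_eval_rbPt_eq_zero i j k {a, b} (mcp_not_all_mem_pair hij hik hjk a b), mul_zero]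
  have h3 : MvPolynomial.eval (rbPt i j k) (∑ a, M a a * rbPsi {a}) = 0 := by
    rw [map_sum]
    refine Finset.sum_eq_zero fun a _ => ?_
    rw [map_mul, rbPsi_eval_rbPt_eq_zero i j k {a} (mcp_not_all_mem_singleton (k := k) hij a), mul_zero]
  have h4 : MvPolynomial.eval (rbPt i j k)
      (∑ a, ∑ b ∈ Finset.univ.erase a, M a b * rbU b * rbPsi {a, b}) = 0 := by
    rw [map_sum]
    refine Finset.sum_eq_zero fun a _ => ?_
    rw [map_sum]
    refine Finset.sum_eq_zero fun b _ => ?_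
    rw [map_mul, rbPsi_eval_rbPt_eq_zero i j k {a, b} (mcp_not_all_mem_pair hij hik hjk a b), mul_zero]
  -- the triple sum collapses to the six orderings of `{i,j,k}`
  have h2 : MvPolynomial.eval (rbPt i j k)
      (∑ a, ∑ b ∈ Finset.univ.erase a, ∑ c ∈ (Finset.univ.erase a).erase b,
        L a b * rbU b * rbU c * rbPsi {a, b, c}) =
      MvPolynomial.eval (rbPt i j k) ((L i j * rbU j + L j i * rbU i) * rbU k +
        (L i k * rbU k + L k i * rbU i) * rbU j + (L j k * rbU k + L k j * rbU j) * rbU i) *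
        MvPolynomial.eval (rbPt i j k) (rbPsi {i, j, k}) := by
    simp only [map_sum]
    rw [mcp_sum3_collapse (fun a b c => MvPolynomial.eval (rbPt i j k) (L a b * rbU b * rbU c * rbPsi {a, b, c}))
      hij hik hjk]
    · have hperm : ∀ a b c : Fin n, ({a, b, c} : Finset (Fin n)) = {i, j, k} →
          MvPolynomial.eval (rbPt i j k) (L a b * rbU b * rbU c * rbPsi {a, b, c}) =
            MvPolynomial.eval (rbPt i j k) (L a b * rbU b * rbU c) *
              MvPolynomial.eval (rbPt i j k) (rbPsi {i, j, k}) := by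
        intro a b c h
        rw [map_mul, h]
      rw [hperm i j k rfl, hperm i k j (by ext; simp; tauto), hperm j i k (by ext; simp; tauto),
        hperm j k i (by ext; simp; tauto), hperm k i j (by ext; simp; tauto),
        hperm k j i (by ext; simp; tauto)]
      simp only [map_add, map_mul]
      ring
    · intro a b c _ _ _ hne
      rw [map_mul, rbPsi_eval_rbPt_eq_zero, mul_zero]
      by_contra hall
      push Not at hall
      apply hne
      refine (Finset.eq_of_subset_of_card_le ?_ ?_).symm
      · intro x hx
        simp only [Finset.mem_insert, Finset.mem_singleton] at hx
        rcases hx with h | h | h <;> rw [h]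
        · exact hall.1
        · exact hall.2.1
        · exact hall.2.2
      · have : ({i, j, k} : Finset (Fin n)).card = 3 := by
          rw [Finset.card_insert_of_notMem (by simp [hij, hik]), Finset.card_insert_of_notMem (by simp [hjk]),
            Finset.card_singleton]
        rw [this]
        exact Finset.card_le_three
  rw [h1, h2, h3, h4, zero_sub, sub_self, add_zero, neg_eq_zero] at hmaster
  exact (mul_eq_zero.1 hmaster).resolve_right (rbPsi_eval_rbPt_ne_zero i j k hij hik hjk)

end

end Summit.ValiantsHypothesis.ValiantsHypothesis.Theorems.ValuativeFlip
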